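import Summits.QuantumFields.YangMills.Theorems.BalabanUVNodesN05SubBHKnitUnivOfThm33
import Literature.MathematicalPhysics.QuantumFieldTheory.Balaban1983to89.B9SupplySockB9P3ZdAtLin
import Literature.MathematicalPhysics.QuantumFieldTheory.Balaban1983to89.B8LeafSocketsB9
import Literature.MathematicalPhysics.QuantumFieldTheory.Balaban1983to89.Node00.CarriersB8CubeSub

/-!
# BalabanUVNodes ∕ N05 ([Balaban1985RegularSpaces] Lemma 1 – Thm 8): THE J-N06→N05 JUNCTION APPLIED ON THE `Ω₀ = ℤᵈ` ROAD, GUARDED-ADDITIVITY EDITION (`LinBddAt` for `GopAddAt`: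
# the one-token image of `BalabanUVNodesN05SubBHKnitUnivOfThm33` (p551339) on dag-n06-b's `B9SupplySockB9P3ZdAtLin` explicit families) — the `Ω₀ = ℤᵈ`-keyed N05 knit
# `BalabanUVNodesN05SubBHKnitUnivT8Srv` (p521275) with its THREE [4]-Thm-3.3-type b9 sockets (`SB9all ∕ SH59src ∕ SB9srcH`) and ALL of Theorem 8's constant
# bookkeeping SUPPLIED from N06's `B9.Thm33Printed` BY NAME (ONE opening; dag-n06-b's one-B₀ supplier `B9SupplySockB9P3ZdAtJoint`) and dag-n06-b's member-local
# operator dictionary at the `Ω₀ = ℤᵈ` law members; the residual layer's [B9] inputs and constants are PRODUCED (∃-currency over the numeric constants only)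

Track A of `YM-PLAN.md` (cell `pub-ymgap`, HUMAN RULING D-0062), node **N05**; seat `pub-ymgap-dag-n05-d` (g8), 2026-08-27; strategy s2 (by-name knit at the record
from the typed interface of the in-edge N06).  Inputs BY NAME: `BalabanUVNodesN05SubBHKnitUnivT8Srv.b8LeafOfRecordSubBH_cutSubB_zdLan_of_knit_lettersRDUB_univ_t8srv`
(this seat g6, p521275: the `Ω₀ = ℤᵈ`-keyed knit, Theorem 8 knit in, its [B8]-own sourced sockets served), `BalabanUVNodesN05SubBHKnitUnivOfThm33`
(p551339: the total-additivity edition, of which this file is the one-token image `hadd : GopAddAt ↦ hlin : LinBddAt`), dag-n06-b's `B9SupplySockB9P3ZdAtJoint` §1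
`sockB9P3_allLevels_univ_explicit_on` (unsourced: seven letters, unchanged) and `B9SupplySockB9P3ZdAtLin` §3 `sockB9P3srcH_univ_explicit_on_lin`, `sockH59src_univ_explicit_on_lin`
(the sourced families with the GUARDED letter `LinBddAt`; same constants), `B8LeafSocketsB9.sockB9P3_mono`,
`Node00.prop6Printed_zdCub_mono` (def-cube).

WHAT IS PROVED (composition BY NAME; no estimate; no new definition):
* ★ **`exists_b8LeafOfRecordSubBH_cutSubB_zdLan_of_thm33_lettersRDU_univ_lin`** — for a Stage-3 parameter `θ` (`D ≥ 2`) and ANY consumer layer `lam₀ : ResidB8 θ` (its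
  Hölder data `β, len`, its axial map, its carriers): from
  (N06, BY NAME) `h33 : B9.Thm33Printed c35 geo bg Gp GA` — [Balaban1985BackgroundPropagators] Theorem 3.3 as typed by the N06 lineage (the `t33` conjunct of the
  `DagBinding` [B9] leaf), opened ONCE;
  (N06 object layer, dag-n06-b's member-local DICTIONARY at the `Ω₀ = ℤᵈ` LAW members `i` — `i.Ω 0 = univ ∧ IdxB8LawsB θ.L i`, the consumers' sub-index of record;
  cube members excluded) `DictAt` (the abstract kernel family `GA` at `mem M i m` IS the concrete operator letter `ops M i m` on `ℤᵈ`, norms identified),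
  `InvAt` ((3.27)), `CurvAt` ((3.69)), `LandauAt` ((3.20)–(3.21)), `AvgAt` ((3.16)), `HolderAt` ((3.43)∕(3.47)), `LinBddAt` (dag-n06-b g15's GUARDED additivity letter:
  `G(U₀)` additive on BOUNDED fields + `D R D*` bounded on bounded fields, replacing the total `GopAddAt` per referee ref-A READ-13's typing note), `SrcAt`, `SrcHolderAt` (the source
  term of (1.146)), and `Prop6At` = [Balaban1985RegularSpaces] Proposition 6 (1.136) in [4]'s dress (3.35) at the member (N05-OWN content, displayed);
  (N06-type letters, no provider in tree) [4] Thm 3.1-type letters `SLet ∕ SLetUB` at the law members and `SLetL ∕ SLetLU` at the Prop.-5 members `ι` (as in p521275);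
  (N05-OWN printed members, displayed) Proposition 6 `p6 : B8.Prop6Printed` on the record's cube family at a consumer threshold `(B₁⁰, c₁)` and Proposition 7
  `p7 : Prop7PrintedR` for `lam₀`'s axial map —
  THERE EXIST [B9] inputs `inp` and constants `C₂ B₁′ B₁ B₂ B₀β` with `B₁⁰ ≤ B₁` such that the REPAIRED slot `B8LeafOfRecordSubBH θ` holds at the cut layer
  `{lam₀ with inp, C₂, B₁′, B₁, B₂, B₀β}.cutSubB J (zdLan θ.L B₁ ∘ ι) c₁`.
  INSIDE: Theorem 3.3 is opened once (`M₁ δ₀ a₀ B₀ Bβ …`); dag-n06-b's three explicit families give `SB9all` at `(B₀′, B₀β′, cP)`, the `SB9srcH` body at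
  `(B₀′, B₀β′, cP, γ″, γβ)` and — after THIS file fixes `B₈ := B₀′ + c_S + max{B₁⁰, 0}` and `B₀″ := 1 + 2F + F(B₈ + 1)∕B₈`, `F := 3(2dL²)B_G B_R` — the `SH59src`
  body at `(B₀′, B₈, B₀″, c59, γ′)`, with B₀′ = max{1, 2B₀max{1,q}} ≥ 1, B₀β′ = 2max{0, C_H Bβ(β)}max{1,q}, γ′ = γ″ = 2c_S∕B₀′, γ₈ = 1; the layer takes
  `inp := (B₀′, B₀″)`, `B₀β := B₀β′ + 1` (`sockB9P3_mono`; the Hölder line of `SB9srcH` has a non-negative bracket), `B₁′ := 5dLB₀′`, `B₁ := 5dLB₈(1 + 11d²) ≥ B₁⁰`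
  (`prop6Printed_zdCub_mono`), `B₂ := 5dLB₈β(1 + 11d²)` with `B₈β := B₀β + B₀β c_S + γβ`, `C₂ := 2²¹(d + 1)²`; every numeric side condition of p521275
  (`hB hB₀β hC₂ hγB hγB″ hB8β hB₁eq hB₂eq hfree hfree2 hfreeS …`) is then arithmetic, and p521275 is applied.
AFTER THIS FILE the `Ω₀ = ℤᵈ` road of N05 displays: N06's Theorem 3.3 BY NAME; dag-n06-b's operator dictionary at the law members (the N06 OBJECT layer: [4] Sect. A +
Thm 3.11 as operators — hypotheses); [4] Thm 3.1-type letters (hypotheses, no provider); and N05's OWN Propositions 6 (twice: `p6` on the cube family, `Prop6At` in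
[4]'s dress) and 7 (`p7`) — nothing else of [Balaban1985RegularSpaces].
A6 (satisfiability of the member-local binders, director-ym №189 (3)): the dictionary binders `DictAt … SrcHolderAt` (with `Prop6At`) are INHABITED at every
truncation-0 member by dag-n06-b's `B9SupplySockB9P3ZdUnivWitness.binders_inhabited_univ_zero` (p544605) ∕ `B9SupplySockB9P3ZdUnivWitnessSrc.binders_inhabited_univ_zero_src`
(p547642) at the trivial massive regime — for the guarded letter set by dag-n06-b's `B9SupplySockB9P3ZdAtLin.binders_inhabited_univ_zero_lin` (p544605's letters alone); members with `m ≥ 1` are A6-UNCHECKED (their inhabitation = [4] Thm 3.11 + Thm 3.3, N06's open object content); the letters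
`SLet ∕ SLetUB ∕ SLetL ∕ SLetLU` have NO in-tree provider or witness at `Ω₀ = ℤᵈ` members (dag-n05-c g7 door (d)); `p7` as typed is junk-inhabitable
(`BalabanUVNodesN05Prop7UnitAxial`), its honest reading `Prop7RepairedC (530d)` is dag-n05-c's `B8Prop7TowerAxialRecord` (species word pending).
HONEST FRAMING: kernel bookkeeping by name + real-constant arithmetic; all sockets ∕ dictionary binders are HYPOTHESES; `p6 ∕ p7 ∕ Prop6At` are HYPOTHESES = N05's own
printed members NOT discharged; count-neutral; **N05 NOT discharged**; Bałaban AS PRINTED with locators; constants sufficient, not optimal; one finite 𝕋⁴ programme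
at fixed ε; nothing continuum ∕ ℝ⁴ ∕ OS ∕ mass-gap ∕ Clay.  No `sorry`, no new definition.  Unit `pub-ymgap-dag-n05-d` (g8), 2026-08-27.
[cite: Balaban1985RegularSpaces, Lemma 1 p.79, Thm 2 p.83, Prop. 3 p.87, Thm 4 p.88, Prop. 5 (1.106)–(1.110) p.94, Thm 8 (1.146) p.101 (supplied modulo the displayed hypotheses), Prop. 6 (1.131)–(1.136) p.99, Prop. 7 p.100 (named hypotheses), p.77 («Ω_j = T_η»); Balaban1985BackgroundPropagators, Thm 3.3 p.399 (by name), Thm 3.1 p.397, (3.16) p.393, (3.20)–(3.27) pp.394–395, (3.35) p.396, (3.41)–(3.47) pp.397–398, (3.69) p.404 (dictionary hypotheses)]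
-/

noncomputable section

namespace Summit.QuantumFields.YangMills.BalabanUVNodes.N05SubBHKnitUnivOfThm33Lin


open Literature.MathematicalPhysics.QuantumFieldTheory.Balaban1983to89
open Literature.MathematicalPhysics.QuantumFieldTheory.Balaban1983to89.Node00
open Literature.MathematicalPhysics.QuantumFieldTheory.Balaban1983to89.B8IdxB8LawsB (towerBonds IdxB8LawsB IdxB8SubB famB8OfRecordSubB)
open Literature.MathematicalPhysics.QuantumFieldTheory.Balaban1983to89.B8LeafModelZd (ZdIdx)
open Literature.MathematicalPhysics.QuantumFieldTheory.Balaban1983to89.B8LeafModelZd3 (SockB9P3)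
open Literature.MathematicalPhysics.QuantumFieldTheory.Balaban1983to89.B8LeafModelZd3H (zdGF3H)
open Literature.MathematicalPhysics.QuantumFieldTheory.Balaban1983to89.B8SockLettersRD (SockLettersRD)
open Literature.MathematicalPhysics.QuantumFieldTheory.Balaban1983to89.B8Lemma1NonAbelian (mulCfg blockPairNA)
open Literature.MathematicalPhysics.QuantumFieldTheory.Balaban1983to89.B8Eq131CubesAdmissible (cubeFam)
open Literature.MathematicalPhysics.QuantumFieldTheory.Balaban1983to89.B8CubeMemberZd (cubeLamS cubeLamB)
open Literature.MathematicalPhysics.QuantumFieldTheory.Balaban1983to89.B8Prop5LandauDataZd (ZdLanIdx zdLan)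
open Literature.MathematicalPhysics.QuantumFieldTheory.Balaban1983to89.B8LanF146 (LanF146)
open Literature.MathematicalPhysics.QuantumFieldTheory.Balaban1983to89.B8LeafSocketsB9 (sockB9P3_mono)
open Literature.MathematicalPhysics.QuantumFieldTheory.Balaban1983to89.B9SupplySockB9P3ZdLetters (OpsZd)
open Literature.MathematicalPhysics.QuantumFieldTheory.Balaban1983to89.B9SupplySockB9P3ZdAt (DictAt Prop6At InvAt CurvAt LandauAt AvgAt HolderAt SrcAt SrcHolderAt)
open Literature.MathematicalPhysics.QuantumFieldTheory.Balaban1983to89.B9SupplySockB9P3ZdAtJoint (sockB9P3_allLevels_univ_explicit_on)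
open Literature.MathematicalPhysics.QuantumFieldTheory.Balaban1983to89.B9SupplySockB9P3ZdAtLin (LinBddAt sockB9P3srcH_univ_explicit_on_lin sockH59src_univ_explicit_on_lin)
open Summit.QuantumFields.YangMills.BalabanUVNodes.N05SubBHKnitUnivT8Srv (b8LeafOfRecordSubBH_cutSubB_zdLan_of_knit_lettersRDUB_univ_t8srv)
open Summit.QuantumFields.YangMills.BalabanUVNodes.N05SubBHKnitUnivOfThm33 (le_bump_of_nonneg)
open MatrixLog B7Prop1Explicit B7Prop2Explicit B7Prop1Local B7Eq92Concrete
open B8Ineq130 (tlo thi)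
open B8Ineq132 (InAk covDerivFwd)
open B7Eq78Linearization (zdBlocking QprimeIter)
open B8Eq119TwistedAxial (bgT Restr129 InAx)
open B8Eq140Level (SideTouches)
open B8Eq138LandauZd (covLap QT InR138 IsLandau146W)
open B8Eq1117Concrete (XSpace)
open B8Prop5ContractionKLevel (Bd2)
open B8LambdaSpaceKLevel (wt)
open B8Eq184Proof (gaugeExp cfgExp)
open B8Eq146AExpansion (iEta)
open B7Prop4GeneralLevels (linCovIter)
open B8Eq155JBound (Jcur wsup wsup_nonneg)
open B8ScaledSupNorm (bondNorm msup Bdd msup_nonneg)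
open B8Thm2LogB (blockTop)
open B8Eq143PlaqExpansion (pdiv)
open B8Eq146AExpansion (plaqCovDeriv)
open B9Eq340HolderZd (hquot AdmPair)

-- `Site` alone could resolve to the torus sites of `Setup.lean`; re-export the `ℤ^d` sites of `B7Prop1Explicit`.
export B7Prop1Explicit (Site)


section JunctionApplied

/-- ★ **THE J-N06→N05 JUNCTION APPLIED ON THE `Ω₀ = ℤᵈ` ROAD (N05's repaired slot at a PRODUCED residual layer)** — from N06's Theorem 3.3 BY NAME (`h33`, opened
once), dag-n06-b's member-local operator dictionary at the `Ω₀ = ℤᵈ` law members (`hdict hP6at hinv hcurv hlan havg hhol hlin hsrc hsrcH`), [4] Thm 3.1-type letters at the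
law members (`SLet ∕ SLetUB`) and at the Prop.-5 members (`SLetL ∕ SLetLU`), and N05's printed Proposition 6 (`p6`, at a consumer threshold `(B₁⁰, c₁)` on the record's cube
family) and Proposition 7 (`p7`, for `lam₀`'s axial map): THERE EXIST [B9] inputs and constants `inp C₂ B₁′ B₁ B₂ B₀β`, `B₁ ≥ B₁⁰`, with
`B8LeafOfRecordSubBH θ ({lam₀ with inp, C₂, B₁′, B₁, B₂, B₀β}.cutSubB J (zdLan θ.L B₁ ∘ ι) c₁)`.  Proof: dag-n06-b's `sockB9P3_allLevels_univ_explicit_on ∕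
sockB9P3srcH_univ_explicit_on ∕ sockH59src_univ_explicit_on` at the sub-index of record `j ↦ j.1.1`, the constants above, then p521275
`b8LeafOfRecordSubBH_cutSubB_zdLan_of_knit_lettersRDUB_univ_t8srv`.  NOT a discharge of N05: the dictionary, the letters, `Prop6At`, `p6`, `p7` are hypotheses.
[cite: Balaban1985RegularSpaces, Lemma 1 p.79, Thm 2 p.83, Prop. 3 p.87, Thm 4 p.88, Prop. 5 p.94, Prop. 6 p.99, Prop. 7 p.100, Thm 8 (1.146) p.101; Balaban1985BackgroundPropagators, Thm 3.3 p.399, Thm 3.1 p.397] -/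
theorem exists_b8LeafOfRecordSubBH_cutSubB_zdLan_of_thm33_lettersRDU_univ_lin {θ : Stage3Params} (hD : 2 ≤ θ.D) (lam₀ : ResidB8 θ)
    -- [4] THM 3.1-TYPE LETTERS at the `Ω₀ = ℤᵈ` LAW MEMBERS (existence side on print's domains; uniqueness side) — hypotheses, as in p521275
    {B₀'H B₂' BG BR cL : ℝ} (hB₀'H : 0 < B₀'H) (hB₂' : 0 ≤ B₂') (hBG : 0 ≤ BG) (hBR : 0 ≤ BR) (hcL : 0 < cL)
    (SLet : ∀ i : ZdIdx θ.D θ.L, i.Ω 0 = Set.univ → IdxB8LawsB θ.L i → SockLettersRD (𝔸 := θ.𝔸) θ.L BG BR B₀'H B₂' cL i.η i.k i.Ω i.Λs)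
    (SLetUB : ∀ i : ZdIdx θ.D θ.L, i.Ω 0 = Set.univ → IdxB8LawsB θ.L i → ∀ α₀ : ℝ, 0 < α₀ → α₀ ≤ cL → ∀ U₀ : Site θ.D → Fin θ.D → θ.𝔸ˣ, (∀ x κ, U₀ x κ ∈ unitaryUnits θ.𝔸) →
      InAk θ.L i.k i.η α₀ i.Ω U₀ →
      ∃ (g Δ : (Site θ.D → θ.𝔸) →ₗ[ℂ] (Site θ.D → θ.𝔸)) (q : (Site θ.D → θ.𝔸) →ₗ[ℂ] (ℕ → Site θ.D → θ.𝔸))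
        (qs : (ℕ → Site θ.D → θ.𝔸) →ₗ[ℂ] (Site θ.D → θ.𝔸)) (Aw c : (ℕ → Site θ.D → θ.𝔸) →ₗ[ℂ] (ℕ → Site θ.D → θ.𝔸))
        (H' : XSpace θ.D i.k θ.𝔸 →ₗ[ℂ] (Site θ.D → θ.𝔸)),
        (∀ x : Site θ.D → θ.𝔸, (∃ C : ℝ, ∀ y, ‖x y‖ ≤ C) → g (Δ x + qs (Aw (q x))) = x) ∧ (∀ φ, qs (c (q (g (g (qs φ))))) = qs φ) ∧
        (∀ (f : Site θ.D → θ.𝔸), ∀ x ∈ i.Ω 0, Δ f x = covLap i.η U₀ ((i.Ω 0).indicator f) x) ∧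
        (∀ (μ : ℕ → Site θ.D → θ.𝔸), ∀ x ∈ i.Ω 0, qs μ x = QT θ.L i.k (i.Λs i.k) U₀ μ x) ∧
        (∀ (f : Site θ.D → θ.𝔸) (n : ℕ), n ≤ i.k → ∀ y ∈ i.Λs i.k n, q f n y = QprimeIter (zdBlocking θ.D θ.L) (bgT θ.L U₀) n f y) ∧
        (∀ (f : Site θ.D → θ.𝔸) (n : ℕ) (y : Site θ.D), ¬ (n ≤ i.k ∧ y ∈ i.Λs i.k n) → q f n y = 0) ∧
        (∀ (X : XSpace θ.D i.k θ.𝔸) (x : Site θ.D), ‖H' X x‖ ≤ B₀'H * ‖X‖) ∧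
        (∀ n, n ≤ i.k → ∀ (X : XSpace θ.D i.k θ.𝔸), ∀ p ∈ {b : Site θ.D × Fin θ.D | SideTouches (i.Ω n) b.1 b.2},
          wt θ.L i.η n * ‖covDerivFwd i.η U₀ p.2 (H' X) p.1‖ ≤ B₀'H * ‖X‖) ∧
        (∀ X : XSpace θ.D i.k θ.𝔸, Bd2 θ.L i.η i.k i.Ω (covLap i.η U₀ (H' X)) (B₂' * ‖X‖)) ∧
        (∀ (Y : XSpace θ.D i.k θ.𝔸) (n : ℕ) (hn : n ≤ i.k) (y : Site θ.D), y ∈ i.Λs i.k n →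
          QprimeIter (zdBlocking θ.D θ.L) (bgT θ.L U₀) n (H' Y) y = Y (⟨n, Nat.lt_succ_of_le hn⟩, y)) ∧
        (∀ (f : Site θ.D → θ.𝔸) (r : ℝ), 0 ≤ r → Bd2 θ.L i.η i.k i.Ω f r →
          (∀ x, ‖g f x‖ ≤ BG * r) ∧ ∀ n, n ≤ i.k → ∀ p ∈ {b : Site θ.D × Fin θ.D | SideTouches (i.Ω n) b.1 b.2},
            wt θ.L i.η n * ‖covDerivFwd i.η U₀ p.2 (g f) p.1‖ ≤ BG * r) ∧
        (∀ (f : Site θ.D → θ.𝔸) (r : ℝ), 0 ≤ r → Bd2 θ.L i.η i.k i.Ω f r → Bd2 θ.L i.η i.k i.Ω (f - g (qs (c (q (g f))))) (BR * r)))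
    -- PROPOSITION 5's INDEX READ AS OBJECTS: `zdLan` members obeying the member laws, with [4]'s letters at each (RD currency), as in p521275
    {J : Type} (ι : J → ZdLanIdx θ.D θ.𝔸)
    (hΩ0L : ∀ a : J, (ι a).Ω 0 = Set.univ) (hΩL : ∀ a : J, ∀ j, (ι a).Ω (j + 1) ⊆ (ι a).Ω j)
    (htowerL : ∀ a : J, ∀ j, j ≤ (ι a).k → ∀ y ∈ (ι a).Λ j, ∀ x, InBox (tlo θ.L y j) (thi θ.L y j) x → x ∈ (ι a).Ω j)
    (SLetL : ∀ a : J, ∀ α₀ : ℝ, 0 < α₀ → α₀ ≤ cL → InAk θ.L (ι a).k (ι a).η α₀ (ι a).Ω (ι a).U₀ →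
      ∃ (g Δ : (Site θ.D → θ.𝔸) →ₗ[ℂ] (Site θ.D → θ.𝔸)) (q : (Site θ.D → θ.𝔸) →ₗ[ℂ] (ℕ → Site θ.D → θ.𝔸))
        (qs : (ℕ → Site θ.D → θ.𝔸) →ₗ[ℂ] (Site θ.D → θ.𝔸)) (Aw c : (ℕ → Site θ.D → θ.𝔸) →ₗ[ℂ] (ℕ → Site θ.D → θ.𝔸))
        (H' : XSpace θ.D (ι a).k θ.𝔸 →ₗ[ℂ] (Site θ.D → θ.𝔸)),
        (∀ x, ∀ y ∈ (ι a).Ω 0, (Δ (g x) + qs (Aw (q (g x)))) y = x y) ∧ (∀ f, q (g (g (qs (c (q f))))) = q f) ∧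
        (∀ (f : Site θ.D → θ.𝔸), ∀ x ∈ (ι a).Ω 0, Δ f x = covLap (ι a).η (ι a).U₀ (((ι a).Ω 0).indicator f) x) ∧
        (∀ (μ : ℕ → Site θ.D → θ.𝔸), ∀ x ∈ (ι a).Ω 0, qs μ x = QT θ.L (ι a).k (ι a).Λ (ι a).U₀ μ x) ∧
        (∀ (f : Site θ.D → θ.𝔸) (j : ℕ), j ≤ (ι a).k → ∀ y ∈ (ι a).Λ j, q f j y = QprimeIter (zdBlocking θ.D θ.L) (bgT θ.L (ι a).U₀) j f y) ∧
        (∀ (X : XSpace θ.D (ι a).k θ.𝔸) (x : Site θ.D), ‖H' X x‖ ≤ B₀'H * ‖X‖) ∧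
        (∀ j, j ≤ (ι a).k → ∀ (X : XSpace θ.D (ι a).k θ.𝔸), ∀ p ∈ {b : Site θ.D × Fin θ.D | SideTouches ((ι a).Ω j) b.1 b.2},
          wt θ.L (ι a).η j * ‖covDerivFwd (ι a).η (ι a).U₀ p.2 (H' X) p.1‖ ≤ B₀'H * ‖X‖) ∧
        (∀ X : XSpace θ.D (ι a).k θ.𝔸, Bd2 θ.L (ι a).η (ι a).k (ι a).Ω (covLap (ι a).η (ι a).U₀ (H' X)) (B₂' * ‖X‖)) ∧
        (∀ (X : XSpace θ.D (ι a).k θ.𝔸) (x : Site θ.D), x ∉ (ι a).Ω 0 → H' X x = 0) ∧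
        (∀ X Y : XSpace θ.D (ι a).k θ.𝔸, (∀ p, Y p = -star (X p)) → ∀ x, H' Y x = -star (H' X x)) ∧
        (∀ (Y : XSpace θ.D (ι a).k θ.𝔸) (j : ℕ) (hj : j ≤ (ι a).k) (y : Site θ.D), y ∈ (ι a).Λ j →
          QprimeIter (zdBlocking θ.D θ.L) (bgT θ.L (ι a).U₀) j (H' Y) y = Y (⟨j, Nat.lt_succ_of_le hj⟩, y)) ∧
        (∀ (f : Site θ.D → θ.𝔸) (r : ℝ), 0 ≤ r → Bd2 θ.L (ι a).η (ι a).k (ι a).Ω f r →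
          (∀ x, ‖g f x‖ ≤ BG * r) ∧ ∀ j, j ≤ (ι a).k → ∀ p ∈ {b : Site θ.D × Fin θ.D | SideTouches ((ι a).Ω j) b.1 b.2},
            wt θ.L (ι a).η j * ‖covDerivFwd (ι a).η (ι a).U₀ p.2 (g f) p.1‖ ≤ BG * r) ∧
        (∀ (f : Site θ.D → θ.𝔸) (x : Site θ.D), x ∉ (ι a).Ω 0 → g f x = 0) ∧
        (∀ f : Site θ.D → θ.𝔸, (∀ j, j ≤ (ι a).k → ∀ x ∈ (ι a).Ω j, IsSelfAdjoint (f x)) → ∀ x, IsSelfAdjoint (g f x)) ∧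
        (∀ (f : Site θ.D → θ.𝔸) (r : ℝ), 0 ≤ r → Bd2 θ.L (ι a).η (ι a).k (ι a).Ω f r →
          Bd2 θ.L (ι a).η (ι a).k (ι a).Ω (f - g (qs (c (q (g f))))) (BR * r)) ∧
        (∀ f : Site θ.D → θ.𝔸, (∀ j, j ≤ (ι a).k → ∀ x ∈ (ι a).Ω j, IsSelfAdjoint (f x)) →
          ∀ j, j ≤ (ι a).k → ∀ x ∈ (ι a).Ω j, IsSelfAdjoint ((f - g (qs (c (q (g f))))) x)))
    (SLetLU : ∀ a : J, ∀ α₀ : ℝ, 0 < α₀ → α₀ ≤ cL → InAk θ.L (ι a).k (ι a).η α₀ (ι a).Ω (ι a).U₀ →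
      ∃ (g Δ : (Site θ.D → θ.𝔸) →ₗ[ℂ] (Site θ.D → θ.𝔸)) (q : (Site θ.D → θ.𝔸) →ₗ[ℂ] (ℕ → Site θ.D → θ.𝔸)) (qs : (ℕ → Site θ.D → θ.𝔸) →ₗ[ℂ] (Site θ.D → θ.𝔸))
        (Aw c : (ℕ → Site θ.D → θ.𝔸) →ₗ[ℂ] (ℕ → Site θ.D → θ.𝔸)) (H' : XSpace θ.D (ι a).k θ.𝔸 →ₗ[ℂ] (Site θ.D → θ.𝔸)),
        (∀ x : Site θ.D → θ.𝔸, (∃ C : ℝ, ∀ y, ‖x y‖ ≤ C) → g (Δ x + qs (Aw (q x))) = x) ∧ (∀ φ, qs (c (q (g (g (qs φ))))) = qs φ) ∧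
        (∀ (f : Site θ.D → θ.𝔸), ∀ x ∈ (ι a).Ω 0, Δ f x = covLap (ι a).η (ι a).U₀ (((ι a).Ω 0).indicator f) x) ∧
        (∀ (μ : ℕ → Site θ.D → θ.𝔸), ∀ x ∈ (ι a).Ω 0, qs μ x = QT θ.L (ι a).k (ι a).Λ (ι a).U₀ μ x) ∧
        (∀ (f : Site θ.D → θ.𝔸) (n : ℕ), n ≤ (ι a).k → ∀ y ∈ (ι a).Λ n, q f n y = QprimeIter (zdBlocking θ.D θ.L) (bgT θ.L (ι a).U₀) n f y) ∧
        (∀ (f : Site θ.D → θ.𝔸) (n : ℕ) (y : Site θ.D), ¬ (n ≤ (ι a).k ∧ y ∈ (ι a).Λ n) → q f n y = 0) ∧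
        (∀ (X : XSpace θ.D (ι a).k θ.𝔸) (x : Site θ.D), ‖H' X x‖ ≤ B₀'H * ‖X‖) ∧
        (∀ n, n ≤ (ι a).k → ∀ (X : XSpace θ.D (ι a).k θ.𝔸), ∀ p ∈ {b : Site θ.D × Fin θ.D | SideTouches ((ι a).Ω n) b.1 b.2},
          wt θ.L (ι a).η n * ‖covDerivFwd (ι a).η (ι a).U₀ p.2 (H' X) p.1‖ ≤ B₀'H * ‖X‖) ∧
        (∀ X : XSpace θ.D (ι a).k θ.𝔸, Bd2 θ.L (ι a).η (ι a).k (ι a).Ω (covLap (ι a).η (ι a).U₀ (H' X)) (B₂' * ‖X‖)) ∧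
        (∀ (Y : XSpace θ.D (ι a).k θ.𝔸) (n : ℕ) (hn : n ≤ (ι a).k) (y : Site θ.D), y ∈ (ι a).Λ n →
          QprimeIter (zdBlocking θ.D θ.L) (bgT θ.L (ι a).U₀) n (H' Y) y = Y (⟨n, Nat.lt_succ_of_le hn⟩, y)) ∧
        (∀ (f : Site θ.D → θ.𝔸) (r : ℝ), 0 ≤ r → Bd2 θ.L (ι a).η (ι a).k (ι a).Ω f r →
          (∀ x, ‖g f x‖ ≤ BG * r) ∧ ∀ n, n ≤ (ι a).k → ∀ p ∈ {b : Site θ.D × Fin θ.D | SideTouches ((ι a).Ω n) b.1 b.2},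
            wt θ.L (ι a).η n * ‖covDerivFwd (ι a).η (ι a).U₀ p.2 (g f) p.1‖ ≤ BG * r) ∧
        (∀ (f : Site θ.D → θ.𝔸) (r : ℝ), 0 ≤ r → Bd2 θ.L (ι a).η (ι a).k (ι a).Ω f r →
          Bd2 θ.L (ι a).η (ι a).k (ι a).Ω (f - g (qs (c (q (g f))))) (BR * r)))
    -- N06 BY NAME: [Balaban1985BackgroundPropagators] THEOREM 3.3 as typed by the N06 lineage (the `t33` conjunct of the [B9] leaf), for an abstract indexed
    -- geometry ∕ background ∕ kernel family, and dag-n06-b's member-local OPERATOR DICTIONARY at the `Ω₀ = ℤᵈ` LAW MEMBERS (object layer: the index map `mem`,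
    -- configuration ∕ location transports `ιCfg ∕ ιLoc`, operator letters `ops`) — hypotheses; `Prop6At` is [Balaban1985RegularSpaces] Prop. 6 (1.136) in
    -- [4]'s dress (3.35), N05-OWN content displayed
    {I : Type} (geo : I → B9.Geometry) (bg : I → B9.Backgrounds) (GA : ∀ i, B9.KernelFamily (geo i) (bg i)) {Gp : ∀ i, B9.KernelFamily (geo i) (bg i)}
    (mem : ℝ → ZdIdx θ.D θ.L → ℕ → I)
    (ιCfg : ∀ (M : ℝ) (i : ZdIdx θ.D θ.L) (m : ℕ) (U₀ : Site θ.D → Fin θ.D → θ.𝔸ˣ), (∀ x κ, U₀ x κ ∈ unitaryUnits θ.𝔸) → (bg (mem M i m)).Cfg)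
    (ιLoc : ∀ (M : ℝ) (i : ZdIdx θ.D θ.L) (m : ℕ), (Site θ.D → Fin θ.D → θ.𝔸) → (geo (mem M i m)).Loc)
    (ops : ℝ → ZdIdx θ.D θ.L → ℕ → OpsZd θ.D θ.𝔸)
    {c35 c₆ K₆ M₃ a₃ c69 q CH cS cSβ : ℝ} (h33 : B9.Thm33Printed c35 geo bg Gp GA)
    (hdict : ∀ (M : ℝ) (i : ZdIdx θ.D θ.L), i.Ω 0 = Set.univ → IdxB8LawsB θ.L i → ∀ m : ℕ, DictAt geo bg GA θ.L mem ιCfg ιLoc ops M i m)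
    (hP6at : ∀ (M : ℝ) (i : ZdIdx θ.D θ.L), i.Ω 0 = Set.univ → IdxB8LawsB θ.L i → ∀ m : ℕ, M₃ ≤ M → Prop6At bg θ.L mem ιCfg c35 c₆ K₆ M i m)
    (hinv : ∀ (M : ℝ) (i : ZdIdx θ.D θ.L), i.Ω 0 = Set.univ → IdxB8LawsB θ.L i → ∀ m : ℕ, M₃ ≤ M → InvAt bg θ.L mem ιCfg ops c35 a₃ M i m)
    (hcurv : ∀ (M : ℝ) (i : ZdIdx θ.D θ.L), i.Ω 0 = Set.univ → IdxB8LawsB θ.L i → ∀ m : ℕ, M₃ ≤ M → CurvAt bg θ.L mem ιCfg ops c35 a₃ c69 M i m)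
    (hlan : ∀ (M : ℝ) (i : ZdIdx θ.D θ.L), i.Ω 0 = Set.univ → IdxB8LawsB θ.L i → ∀ m : ℕ, M₃ ≤ M → LandauAt bg θ.L mem ιCfg ops c35 a₃ M i m)
    (havg : ∀ (M : ℝ) (i : ZdIdx θ.D θ.L), i.Ω 0 = Set.univ → IdxB8LawsB θ.L i → ∀ m : ℕ, AvgAt θ.L ops q M i m)
    (hhol : ∀ (M : ℝ) (i : ZdIdx θ.D θ.L), i.Ω 0 = Set.univ → IdxB8LawsB θ.L i → ∀ m : ℕ, HolderAt geo bg GA θ.L mem ιCfg ops lam₀.β lam₀.len CH M i m)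
    (hlin : ∀ (M : ℝ) (i : ZdIdx θ.D θ.L), i.Ω 0 = Set.univ → IdxB8LawsB θ.L i → ∀ m : ℕ, LinBddAt θ.L ops M i m)
    (hsrc : ∀ (M : ℝ) (i : ZdIdx θ.D θ.L), i.Ω 0 = Set.univ → IdxB8LawsB θ.L i → ∀ m : ℕ, M₃ ≤ M → SrcAt bg θ.L mem ιCfg ops c35 a₃ cS M i m)
    (hsrcH : ∀ (M : ℝ) (i : ZdIdx θ.D θ.L), i.Ω 0 = Set.univ → IdxB8LawsB θ.L i → ∀ m : ℕ, M₃ ≤ M →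
      SrcHolderAt bg θ.L mem ιCfg ops c35 a₃ lam₀.β lam₀.len cSβ M i m)
    (hc₆ : 0 < c₆) (hK₆ : 0 < K₆) (ha₃ : 0 < a₃) (hc69 : 0 ≤ c69) (hq : 0 ≤ q) (hcS : 0 ≤ cS) (hcSβ : 0 ≤ cSβ)
    -- N05's OWN PRINTED MEMBERS (displayed hypotheses): Proposition 6 on the record's cube family at a consumer threshold `(B₁⁰, c₁)`; Proposition 7 for `lam₀`'s axial map
    (B₁₀ c₁ : ℝ) (p6 : B8.Prop6Printed θ.D (θ.L : ℝ) B₁₀ c₁ (fun j : IdxB8SubB θ => cubB8OfRecord θ j.1))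
    (p7 : B8SectGH.Prop7PrintedR (fun j : IdxB8SubB θ => famB8OfRecordSubB θ lam₀.β lam₀.len j) (fun j => lam₀.toAxial j.1)) :
    ∃ (inp : B8.B9Inputs) (C₂ B₁' B₁ B₂ B₀β : ℝ), B₁₀ ≤ B₁ ∧
      B8LeafOfRecordSubBH θ (({ lam₀ with inp := inp, C₂ := C₂, B₁' := B₁', B₁ := B₁, B₂ := B₂, B₀β := B₀β } : ResidB8 θ).cutSubB J
        (fun a : J => zdLan θ.L B₁ (ι a)) c₁) := by
  -- dimension ∕ block-size arithmetic: `2 ≤ L`, `20 ≤ 5dL`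
  have hL1 : 1 ≤ θ.L := le_trans (by norm_num) θ.two_le_L
  have hDr : (2 : ℝ) ≤ θ.D := by exact_mod_cast hD
  have hLr : (2 : ℝ) ≤ θ.L := by exact_mod_cast θ.two_le_L
  have hDL : (2 : ℝ) * 2 ≤ (θ.D : ℝ) * θ.L := mul_le_mul hDr hLr (by norm_num) (by linarith)
  have h20 : (20 : ℝ) ≤ 5 * (θ.D : ℝ) * θ.L := by linarith
  have h5 : (0 : ℝ) ≤ 5 * (θ.D : ℝ) * θ.L := by linarith
  -- ONE opening of N06's Theorem 3.3
  obtain ⟨M₁, δ₀, a₀, B₀, Bβ, Bε, Bεβ, -, -, ha₀, hB₀, H⟩ := h33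
  have H' : ∀ i : I, M₁ ≤ (geo i).M → ∀ α₀ : ℝ, 0 < α₀ → (geo i).M * α₀ ≤ a₀ →
      ∀ U : (bg i).Cfg, (bg i).Reg335 c35 α₀ U →
        B9.Ineq342_346_347 (GA i) B₀ δ₀ U ∧ B9.Ineq343_345 (GA i) Bβ Bε Bεβ δ₀ U :=
    fun i hMi α₀ hα₀ hMa U hreg => (H i hMi α₀ hα₀ hMa U hreg).2
  obtain ⟨M, hM_def⟩ : ∃ M : ℝ, M = max 1 (max M₁ M₃) := ⟨_, rfl⟩
  have hM1 : 1 ≤ M := by rw [hM_def]; exact le_max_left _ _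
  have hMM₁ : M₁ ≤ M := by rw [hM_def]; exact (le_max_left _ _).trans (le_max_right _ _)
  have hMM₃ : M₃ ≤ M := by rw [hM_def]; exact (le_max_right _ _).trans (le_max_right _ _)
  have hM0 : 0 < M := lt_of_lt_of_le one_pos hM1
  have hKM : 0 < K₆ * M := mul_pos hK₆ hM0
  -- dag-n06-b's three explicit families at the SUB-INDEX OF RECORD `j : IdxB8SubB θ ↦ j.1.1` (the `Ω₀ = ℤᵈ` law members)
  have hSB9 := sockB9P3_allLevels_univ_explicit_on geo bg GA θ.L mem ιCfg ιLoc ops hD hL1 hB₀ H' hM1 hMM₁ hMM₃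
    (fun j : IdxB8SubB θ => j.1.1) (fun j => j.1.2) (fun M j m => hdict M j.1.1 j.1.2 j.2 m) (fun M j m hM => hP6at M j.1.1 j.1.2 j.2 m hM)
    (fun M j m hM => hinv M j.1.1 j.1.2 j.2 m hM) (fun M j m hM => hcurv M j.1.1 j.1.2 j.2 m hM) (fun M j m hM => hlan M j.1.1 j.1.2 j.2 m hM)
    (fun M j m => havg M j.1.1 j.1.2 j.2 m) (fun M j m => hhol M j.1.1 j.1.2 j.2 m) hK₆ hc69 hq
  have hSrcH := sockB9P3srcH_univ_explicit_on_lin geo bg GA θ.L mem ιCfg ιLoc ops hD hL1 hB₀ H' hM1 hMM₁ hMM₃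
    (fun j : IdxB8SubB θ => j.1.1) (fun j => j.1.2) (fun M j m => hdict M j.1.1 j.1.2 j.2 m) (fun M j m hM => hP6at M j.1.1 j.1.2 j.2 m hM)
    (fun M j m hM => hinv M j.1.1 j.1.2 j.2 m hM) (fun M j m hM => hcurv M j.1.1 j.1.2 j.2 m hM)
    (fun M j m => havg M j.1.1 j.1.2 j.2 m) (fun M j m => hhol M j.1.1 j.1.2 j.2 m) (fun M j m => hlin M j.1.1 j.1.2 j.2 m)
    (fun M j m hM => hsrc M j.1.1 j.1.2 j.2 m hM) (fun M j m hM => hsrcH M j.1.1 j.1.2 j.2 m hM) hK₆ hc69 hq hcS hcSβ 1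
  -- the PRODUCED constants
  set B₀' : ℝ := max 1 (2 * B₀ * max 1 q) with hB₀'_def
  set B₀β' : ℝ := 2 * max 0 (CH * Bβ lam₀.β) * max 1 q with hB₀β'_def
  set cP : ℝ := min (1 / 16) (min (c₆ / M) (min (a₀ / (K₆ * M)) (min (a₃ / (K₆ * M)) (1 / (2 * B₀ * c69 * K₆ * M + 1))))) with hcP_def
  have hB₀'1 : 1 ≤ B₀' := le_max_left _ _
  have hB₀'0 : 0 < B₀' := lt_of_lt_of_le one_pos hB₀'1
  have hB₀β'0 : 0 ≤ B₀β' := by rw [hB₀β'_def]; positivity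
  have hcP : 0 < cP := by
    rw [hcP_def]
    refine lt_min (by norm_num) (lt_min (div_pos hc₆ hM0) (lt_min (div_pos ha₀ hKM) (lt_min (div_pos ha₃ hKM) ?_)))
    have : 0 < 2 * B₀ * c69 * K₆ * M + 1 := by positivity
    positivity
  -- Theorem 8's `B₈` (≥ `B₀′`, absorbing `γ′B₀′ = 2c_S`, and ≥ the consumer's Prop.-6 threshold `B₁⁰`) and the free constant `B₀″` of the Prop.-5 providers
  obtain ⟨B₈, hB₈_def⟩ : ∃ x : ℝ, x = B₀' + cS + max B₁₀ 0 := ⟨_, rfl⟩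
  have hB₈0 : 0 < B₈ := by rw [hB₈_def]; positivity
  have hB₀8 : B₀' ≤ B₈ := by rw [hB₈_def]; linarith [le_max_right B₁₀ 0]
  have hB₁₀8 : B₁₀ ≤ B₈ := by rw [hB₈_def]; linarith [le_max_left B₁₀ 0]
  obtain ⟨F, hF_def⟩ : ∃ x : ℝ, x = 3 * (2 * (θ.D : ℝ) * (θ.L : ℝ) ^ 2) * BG * BR := ⟨_, rfl⟩
  have hF0 : 0 ≤ F := by rw [hF_def]; positivity
  obtain ⟨B₀'', hB₀''_def⟩ : ∃ x : ℝ, x = 1 + 2 * F + F * (B₈ + 1) / B₈ := ⟨_, rfl⟩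
  have hFB : 0 ≤ F * (B₈ + 1) / B₈ := by positivity
  have hB₀''0 : 0 < B₀'' := by rw [hB₀''_def]; positivity
  have hfree : F ≤ B₀'' := by rw [hB₀''_def]; linarith
  have hfree2 : F ≤ B₀'' / 2 := by rw [hB₀''_def]; linarith
  have hfreeS : F * (B₈ + 1) ≤ B₀'' * B₈ := by
    have h1 : F * (B₈ + 1) = F * (B₈ + 1) / B₈ * B₈ := by field_simp
    rw [h1]
    exact mul_le_mul_of_nonneg_right (by rw [hB₀''_def]; linarith) hB₈0.le
  -- the `SH59src` family for THIS `B₈`, `B₀″`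
  have h59 := sockH59src_univ_explicit_on_lin geo bg GA θ.L mem ιCfg ιLoc ops hD hL1 hB₀ H' hM1 hMM₁ hMM₃
    (fun j : IdxB8SubB θ => j.1.1) (fun j => j.1.2) (fun M j m => hdict M j.1.1 j.1.2 j.2 m) (fun M j m hM => hP6at M j.1.1 j.1.2 j.2 m hM)
    (fun M j m hM => hinv M j.1.1 j.1.2 j.2 m hM) (fun M j m hM => hcurv M j.1.1 j.1.2 j.2 m hM)
    (fun M j m => havg M j.1.1 j.1.2 j.2 m) (fun M j m => hhol M j.1.1 j.1.2 j.2 m) (fun M j m => hlin M j.1.1 j.1.2 j.2 m)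
    (fun M j m hM => hsrc M j.1.1 j.1.2 j.2 m hM) (fun M j m hM => hsrcH M j.1.1 j.1.2 j.2 m hM) hK₆ hc69 hq hcS hcSβ 1 hB₈0 hB₀''0.le
  -- the remaining produced constants
  have hK₀ : 0 < 2 * (θ.L * (5 * (θ.D : ℝ) * θ.L * B₈)) + 8 * (8 * B₀'' * (5 * (θ.D : ℝ) * θ.L * B₈)) := by
    have h1 : 0 < 2 * (θ.L * (5 * (θ.D : ℝ) * θ.L * B₈)) := by positivity
    have h2 : 0 ≤ 8 * (8 * B₀'' * (5 * (θ.D : ℝ) * θ.L * B₈)) := by positivity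
    linarith
  have hc59 : 0 < min cP (cP / (2 * (θ.L * (5 * (θ.D : ℝ) * θ.L * B₈)) + 8 * (8 * B₀'' * (5 * (θ.D : ℝ) * θ.L * B₈)))) :=
    lt_min hcP (div_pos hcP hK₀)
  have hγ'0 : 0 ≤ 2 * cS * 1 / B₀' := by positivity
  have hγ'B : 2 * cS * 1 / B₀' * B₀' = 2 * cS := by field_simp
  have hγβ0 : 0 ≤ (max 0 (CH * Bβ lam₀.β) * cS / B₀ + cSβ) * 1 := by positivity
  obtain ⟨B₈β, hB₈β_def⟩ : ∃ x : ℝ, x = (B₀β' + 1) + (B₀β' + 1) * cS + (max 0 (CH * Bβ lam₀.β) * cS / B₀ + cSβ) * 1 := ⟨_, rfl⟩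
  -- the layer's numeric side conditions (p521275's `hB hγB hγB'' hB8β hfreeS …`)
  have hB : 2 ≤ 5 * (θ.D : ℝ) * θ.L * B₀' := by
    have h1 : 5 * (θ.D : ℝ) * θ.L * 1 ≤ 5 * (θ.D : ℝ) * θ.L * B₀' := mul_le_mul_of_nonneg_left hB₀'1 h5
    linarith
  have hγB : 5 * (θ.D : ℝ) * θ.L * B₀' + 2 * (2 * cS * 1 / B₀' * B₀') ≤ 5 * (θ.D : ℝ) * θ.L * B₈ := by
    rw [hγ'B, hB₈_def]
    have h4 : 4 * cS ≤ 5 * (θ.D : ℝ) * θ.L * cS := mul_le_mul_of_nonneg_right (by linarith) hcS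
    have hm : 0 ≤ 5 * (θ.D : ℝ) * θ.L * max B₁₀ 0 := mul_nonneg h5 (le_max_right _ _)
    linarith
  have hB8β : 5 * (θ.D : ℝ) * θ.L * (B₀β' + 1) + 2 * (B₀β' + 1) * (2 * cS * 1 / B₀' * B₀') + (max 0 (CH * Bβ lam₀.β) * cS / B₀ + cSβ) * 1
      ≤ 5 * (θ.D : ℝ) * θ.L * B₈β := by
    rw [hγ'B, hB₈β_def]
    have hb1 : 0 ≤ B₀β' + 1 := by linarith
    have h4 : 4 * ((B₀β' + 1) * cS) ≤ 5 * (θ.D : ℝ) * θ.L * ((B₀β' + 1) * cS) := mul_le_mul_of_nonneg_right (by linarith) (mul_nonneg hb1 hcS)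
    have h1 : 1 * ((max 0 (CH * Bβ lam₀.β) * cS / B₀ + cSβ) * 1) ≤ 5 * (θ.D : ℝ) * θ.L * ((max 0 (CH * Bβ lam₀.β) * cS / B₀ + cSβ) * 1) :=
      mul_le_mul_of_nonneg_right (by linarith) hγβ0
    linarith
  have hfreeS' : 3 * (2 * (θ.D : ℝ) * (θ.L : ℝ) ^ 2) * BG * BR * (B₈ + 1) ≤ B₀'' * B₈ := by rw [← hF_def]; exact hfreeS
  have hfree' : 3 * (2 * (θ.D : ℝ) * (θ.L : ℝ) ^ 2) * BG * BR ≤ B₀'' := by rw [← hF_def]; exact hfree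
  have hfree2' : 3 * (2 * (θ.D : ℝ) * (θ.L : ℝ) ^ 2) * BG * BR ≤ B₀'' / 2 := by rw [← hF_def]; exact hfree2
  have hD1 : (1 : ℝ) ≤ 5 * (θ.D : ℝ) * θ.L * (1 + 11 * (θ.D : ℝ) ^ 2) := by
    have hsq : (0 : ℝ) ≤ 11 * (θ.D : ℝ) ^ 2 := by positivity
    have h1 : 5 * (θ.D : ℝ) * θ.L * 1 ≤ 5 * (θ.D : ℝ) * θ.L * (1 + 11 * (θ.D : ℝ) ^ 2) := mul_le_mul_of_nonneg_left (by linarith) h5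
    linarith
  have hB₁₀le : B₁₀ ≤ 5 * (θ.D : ℝ) * θ.L * B₈ * (1 + 11 * (θ.D : ℝ) ^ 2) := by
    have h1 : B₈ * 1 ≤ B₈ * (5 * (θ.D : ℝ) * θ.L * (1 + 11 * (θ.D : ℝ) ^ 2)) := mul_le_mul_of_nonneg_left hD1 hB₈0.le
    have h2 : B₈ * (5 * (θ.D : ℝ) * θ.L * (1 + 11 * (θ.D : ℝ) ^ 2)) = 5 * (θ.D : ℝ) * θ.L * B₈ * (1 + 11 * (θ.D : ℝ) ^ 2) := by ring
    linarith
  -- Proposition 6 at the produced `B₁ ≥ B₁⁰` (def-cube's monotonicity on the `zdCub` members of record)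
  have p6' : B8.Prop6Printed θ.D (θ.L : ℝ) (5 * (θ.D : ℝ) * θ.L * B₈ * (1 + 11 * (θ.D : ℝ) ^ 2)) c₁ (fun j : IdxB8SubB θ => cubB8OfRecord θ j.1) :=
    prop6Printed_zdCub_mono θ.𝔸 (fun j : IdxB8SubB θ => j.1.1) hB₁₀le le_rfl p6
  -- THE LAYER and p521275
  refine ⟨⟨B₀', B₀'', hB₀'0, hB₀''0⟩, 2097152 * ((θ.D : ℝ) + 1) ^ 2, 5 * (θ.D : ℝ) * θ.L * B₀', 5 * (θ.D : ℝ) * θ.L * B₈ * (1 + 11 * (θ.D : ℝ) ^ 2),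
    5 * (θ.D : ℝ) * θ.L * B₈β * (1 + 11 * (θ.D : ℝ) ^ 2), B₀β' + 1, hB₁₀le, ?_⟩
  -- (the layer is passed EXPLICITLY: no metavariable-laden `rfl` over real arithmetic — DESIGN-DATUM-R0)
  exact b8LeafOfRecordSubBH_cutSubB_zdLan_of_knit_lettersRDUB_univ_t8srv (γ₈ := 1) (γ' := 2 * cS * 1 / B₀') (γ'' := 2 * cS * 1 / B₀')
    (γβ := (max 0 (CH * Bβ lam₀.β) * cS / B₀ + cSβ) * 1) (B₈ := B₈) (B₈β := B₈β) (cB9 := cP) (cP3 := cP)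
    ({ lam₀ with
        inp := ⟨B₀', B₀'', hB₀'0, hB₀''0⟩, C₂ := 2097152 * ((θ.D : ℝ) + 1) ^ 2, B₁' := 5 * (θ.D : ℝ) * θ.L * B₀',
        B₁ := 5 * (θ.D : ℝ) * θ.L * B₈ * (1 + 11 * (θ.D : ℝ) ^ 2), B₂ := 5 * (θ.D : ℝ) * θ.L * B₈β * (1 + 11 * (θ.D : ℝ) ^ 2),
        B₀β := B₀β' + 1 } : ResidB8 θ)
    hD rfl hB (show 0 < B₀β' + 1 by linarith) le_rfl hcP hB₀'H hB₂' hBG hBR hcL hfree' hfree2'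
    SLet SLetUB (fun i hiΩ hiL m hm => sockB9P3_mono le_rfl (show B₀β' ≤ B₀β' + 1 by linarith) i.hη.le (hSB9 ⟨⟨i, hiΩ⟩, hiL⟩ m hm))
    ι hΩ0L hΩL htowerL SLetL SLetLU c₁ p6' p7 hc59 hcP le_rfl hγ'0 hγ'0 hB₀8 hγB hγB hB8β rfl rfl hfreeS'
    (fun i hiΩ hiL => h59 ⟨⟨i, hiΩ⟩, hiL⟩)
    (fun i hiΩ hiL α₀ α₁ α₂ h1 h2 h3 h4 h5 U₀ W hU₀ hW f hR hsa hf0 hBd hms hmsD hA1 hA2 hLW A' hA hWA hA0 => by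
      obtain ⟨r1, r2, r3, r4, r5⟩ := hSrcH ⟨⟨i, hiΩ⟩, hiL⟩ α₀ α₁ α₂ h1 h2 h3 h4 h5 U₀ W hU₀ hW f hR hsa hf0 hBd hms hmsD hA1 hA2 hLW A' hA hWA hA0
      exact ⟨r1, r2, r3, r4, le_bump_of_nonneg (add_nonneg (by unfold bondNorm; exact msup_nonneg _ _ i.hη.le _ _ _) (wsup_nonneg zero_le_one _))
        (show B₀β' ≤ B₀β' + 1 by linarith) r5⟩)

end JunctionApplied

#print axioms exists_b8LeafOfRecordSubBH_cutSubB_zdLan_of_thm33_lettersRDU_univ_lin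

end Summit.QuantumFields.YangMills.BalabanUVNodes.N05SubBHKnitUnivOfThm33Lin

end
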